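import Mathlib.Algebra.BigOperators.Group.Finset.Basic
import Literature.Computability.Complexity.StackPrograms
import HarnessLib

/-!
# The token-register while loop on `Com`: a generic simulation rule

Trunk complexity toolkit, continuing `StackPrograms.lean`.  The one loop construct of the
structured stack programs `Com ι` is `loop k ct cf` — pop register `k` and run `ct`/`cf` on the
popped bit, until `k` is empty.  A data-dependent **while loop** is obtained by looping on a
*token register* `W` holding at most one token `1`: the body decides whether to continue by
pushing the token back (`StackWhile.lean` does this for the alphabet programs `ACom`;
`StackItemPop.lean` is a first instance on `Com`).  This file proves the generic rule once:

* **`Com.runs_tokenLoop`**: let `enc x` be the register file of an abstract state `x : σ`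
  (token register empty), `step : σ → Option σ` the abstract body (`none` = exit) with files
  `fin x` on exit, and suppose the body `Runs` from `enc x` to `enc y` plus the token when
  `step x = some y`, and to `fin x` when `step x = none`, within `cost x`.  Then along any
  trajectory `f 0, f 1, …, f n` of `step` that exits at `f n`, the loop started with the token
  runs to `fin (f n)` within `∑_{i ≤ n} (cost (f i) + 2) + 1` steps;
* `Com.runs_tokenLoop_const`: the same with a uniform bound `cost ≤ c`:
  `(n + 1) · (c + 2) + 1` steps.

So a while loop costs its iterations plus `2` per round — the interface needed for
(quasi-)linear-time routines (merging, scanning, FFT passes) on `Com`.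

## References

* T. Nipkow, G. Klein, *Concrete Semantics with Isabelle/HOL*, Springer 2014, §7.2, Lemma 7.x
  (while rule of big-step semantics) and Ch. 8. (Not held; standard, fully proved here.)
-/

namespace Literature.Computability.Complexity

open Finset

namespace Com

variable {ι : Type} [DecidableEq ι] {σ : Type}

/-- Putting the token on an encoded state and taking it off again. [folklore] -/
theorem update_token_clear {W : ι} {R : Regs ι} (hW : R W = []) :
    Function.update (Function.update R W [true]) W [] = R := by
  rw [Function.update_idem, ← hW, Function.update_eq_self]

/-- **The token-loop rule.**  `W` the token register, `body` the loop body; `enc x` the file of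
state `x` with `W` empty, `fin x` the file after an exiting round (also `W` empty);
`step x = some y`: a continuing round runs from `enc x` to `enc y` with the token pushed back;
`step x = none`: an exiting round runs from `enc x` to `fin x`.  Along a trajectory
`f 0 → f 1 → ⋯ → f n` exiting at `f n`, `loop W body cf` started on `enc (f 0)` plus the token
ends in `fin (f n)` within `∑_{i<n+1} (cost (f i) + 2) + 1` steps. [folklore] -/
theorem runs_tokenLoop (W : ι) (body cf : Com ι) (enc fin : σ → Regs ι) (step : σ → Option σ)
    (cost : σ → ℕ) (hW : ∀ x, enc x W = []) (hfinW : ∀ x, fin x W = [])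
    (hsome : ∀ x y, step x = some y →
      Runs body (enc x) (Function.update (enc y) W [true]) (cost x))
    (hnone : ∀ x, step x = none → Runs body (enc x) (fin x) (cost x)) :
    ∀ (n : ℕ) (f : ℕ → σ), (∀ i < n, step (f i) = some (f (i + 1))) → step (f n) = none →
      Runs (loop W body cf) (Function.update (enc (f 0)) W [true]) (fin (f n))
        (∑ i ∈ range (n + 1), (cost (f i) + 2) + 1) := by
  intro n
  induction n with
  | zero =>
    intro f _ hstop
    have h1 := hnone (f 0) hstop
    have h2 : Runs (loop W body cf) (fin (f 0)) (fin (f 0)) 1 := Runs.loop_nil _ _ (hfinW _)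
    have := Runs.loop_true' (R := Function.update (enc (f 0)) W [true]) (w := [])
      (by simp) (update_token_clear (hW (f 0))) h1 h2
    refine this.mono ?_
    simp
  | succ n ih =>
    intro f htraj hstop
    have h1 := hsome (f 0) (f 1) (htraj 0 (Nat.succ_pos n))
    have h2 := ih (fun i => f (i + 1)) (fun i hi => htraj (i + 1) (by omega)) hstop
    have := Runs.loop_true' (R := Function.update (enc (f 0)) W [true]) (w := [])
      (by simp) (update_token_clear (hW (f 0))) h1 h2
    refine this.mono (le_of_eq ?_)
    rw [sum_range_succ' (fun i => cost (f i) + 2) (n + 1)]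
    ring

/-- **The token-loop rule with a uniform cost bound**: if every round costs at most `c`, a
trajectory of `n + 1` rounds costs at most `(n + 1)(c + 2) + 1`. [folklore] -/
theorem runs_tokenLoop_const (W : ι) (body cf : Com ι) (enc fin : σ → Regs ι)
    (step : σ → Option σ) (c : ℕ) (hW : ∀ x, enc x W = []) (hfinW : ∀ x, fin x W = [])
    (hsome : ∀ x y, step x = some y → Runs body (enc x) (Function.update (enc y) W [true]) c)
    (hnone : ∀ x, step x = none → Runs body (enc x) (fin x) c)
    (n : ℕ) (f : ℕ → σ) (htraj : ∀ i < n, step (f i) = some (f (i + 1)))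
    (hstop : step (f n) = none) :
    Runs (loop W body cf) (Function.update (enc (f 0)) W [true]) (fin (f n))
      ((n + 1) * (c + 2) + 1) := by
  have := runs_tokenLoop W body cf enc fin step (fun _ => c) hW hfinW hsome hnone n f htraj hstop
  refine this.mono (le_of_eq ?_)
  simp [sum_const, card_range]

end Com

end Literature.Computability.Complexity
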